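import Mathlib
import Literature.MathematicalPhysics.QuantumLattice.WilsonDiracAP
import Summits.QuantumFields.QCD.Theorems.QuarksAsStableActionCriticalLineDiamagnetismStubBilinearBounds
import Summits.QuantumFields.QCD.Theorems.WilsonQuarkChessboardFlatCellOptimalStubTangentDeltaBAllN
import Summits.QuantumFields.QCD.Theorems.WilsonQuarkChessboardFlatCellOptimalStubTadpoleAuxAllN

/-!
# Bilinear bounds for the one-loop block functionals, `N` colours, dimension-free constants
(helper for crux stmt-QuantumFields-9307 `FlatCellOptimal`, line `registered`, stubs
`stub_hessianMarginAllN` (G2) / `stub_localNormGain_of` (G4), sub-goal `stub_bilinearBoundsAllN` —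
the `Fin 3 ↦ Fin N` port of the sibling crux stmt-QuantumFields-9734's `…CriticalLineDiamagnetismStubBilinearBounds`,
gap G2a, wave 9)

What.  On the `2⁴` block `(ℤ/2)⁴` (colour `Fin N`, ANY `N : ℕ`, spin `Fin 4`; index type
`TorusSite 4 2 × Fin N × Fin 4`, `64N`-dimensional) let `B⁰ = wilsonDirac ρ_N (fun e => u e.2) m 1`
be the free `r = 1` Wilson–Dirac operator with constant direction-dependent unitary links
`u_μ ∈ U(N)` and `Δ(E)` the hopping perturbation, ℝ-linear in the link field `E : Edge 4 2 → M_N(ℂ)`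
(forward hop `(1 − γ_μ) ⊗ u_μ E(x,μ)`, backward hop `(1 + γ_μ) ⊗ (u_μ E(y,μ))ᴴ`, prefactor `−½`;
both given by defining equations, no `let`).  If `B⁰` is coercive, `c₀ Σ_i ‖v_i‖² ≤ Σ_i ‖(B⁰ v)_i‖²`
with `c₀ > 0`, then (`stub_bilinearBoundsAllN`):
(a) `Δ(E₁ + E₂) = Δ(E₁) + Δ(E₂)`; (b) `Δ(r • E) = r • Δ(E)` for real `r`;
(c) the bubble `𝔅(E₁,E₂) = Re tr (B⁰⁻¹ Δ(E₁) B⁰⁻¹ Δ(E₂))` obeys `|𝔅(E₁,E₂)| ≤ (32/c₀) ‖E₁‖ ‖E₂‖`;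
(d) the tadpole `ℓ(E) = Re tr (B⁰⁻¹ Δ(E))` AT THE COLOUR-SCALAR TEST FIELDS `tst_μ = (1/N)·1` on the
single link `(0, μ)` obeys `|ℓ(tst_μ)| ≤ 80/√c₀` for each `μ`.
All four constants are independent of `N` (and of `u`, `m`).

Why (d) changes shape.  The sibling's (d) `|ℓ(E)| ≤ (80/√c₀) ‖E‖` for a GENERAL link field `E` is
Cauchy–Schwarz against `‖B⁰⁻¹‖_F ≤ √(card/c₀)`, `card = 192 ↦ 64N`, so its honest all-`N` form is
`|ℓ(E)| ≤ √(2048 N/c₀) ‖E‖` — genuinely `N`-dependent (`E = ε·1` on one link: `ℓ ∼ εN`,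
`‖E‖ = ε√N`).  Its ONLY downstream use (the assembly `stub_oneLoopMargin_of`, hypothesis block `Bd`,
step `hell_tst`) is at `E = tst_μ`, where `‖tst_μ‖² = N · (1/N)² = 1/N` exactly compensates:
`64N · 32 · (1/N) = 2048 ≤ 80²`.  So (d) is stated at `tst_μ` (constant `80` kept, so the sibling's
bookkeeping `|T_μ| ≤ 80 Λ` ports verbatim); the general tadpole `ℓ(E)` is handled downstream EXACTLY by
the Ward/tadpole formula `ℓ(E) = Σ_μ ℓ(tst_μ) · Re tr Σ_x E(x,μ)` (`…FlatCellOptimal.Tadpole.stub_tadpoleAllN`).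

How.  (a), (b): the hopping form `H(C⁺, C⁻)` of `…StubTadpoleAuxAllN` is additive and homogeneous in
its colour blocks (`Tadpole.hop_add`, `Tadpole.hop_smul`) and `Δ(E) = H(uE, (uE)ᴴ)`.
(c): `|Re tr (P Q)| ≤ ‖P‖_F ‖Q‖_F` and `‖B⁰⁻¹ Δ‖_F² ≤ ‖Δ‖_F² / c₀` — the sibling's generic (index-type
free) `BilinearBounds.abs_re_trace_mul_le` / `abs_re_trace_bubble_le`, re-EXPORTED here (no
restatement) — and `‖Δ(E)‖_F² ≤ 32 ‖E‖²` (`hop_frob_le`, from `TangentDelta.frob_kernel_le`,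
`‖1 ∓ γ_μ‖_F² = 8`, unitary invariance; `N` colours).
(d): `|Re tr (B⁰⁻¹ Δ)| ≤ √(card · ‖Δ‖_F² / c₀)` (`abs_re_trace_inv_mul_le_card`, from
`StubDetPerturbIRAux.re_trace_inv_mul_le` applied to `±Δ`), `card = 64N` (`card_index`),
`‖tst_μ‖² = N (1/N)²` (`tst_frob`), `N · (1/N) ≤ 1`.

Sources.  Montvay–Münster, *Quantum Fields on a Lattice* §4.2 (Wilson fermions, hopping
expansion); folklore finite-dimensional linear algebra.  Pure theorem file (no `def`s); pattern:
sibling `…StubBilinearBounds`, port siblings `…StubTangentDeltaBAllN`, `…StubTadpoleAuxAllN`.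
-/

noncomputable section

open scoped BigOperators Classical Matrix ComplexConjugate
open Finset
open Literature.MathematicalPhysics.QuantumLattice Literature.MathematicalPhysics.QuantumFieldTheory
  Literature.Probability.LatticeModels

namespace Summit.QuantumFields.QCD.Cruxes.FlatCellOptimal.BilinearBounds

/-! ### Colour-free lemmas of the sibling file, re-exported -/

export Summit.QuantumFields.QCD.Cruxes.CriticalLineDiamagnetism.ChessboardCellGain.BilinearBounds
  (abs_re_trace_mul_le abs_re_trace_bubble_le)

open Summit.QuantumFields.QCD.Cruxes.CriticalLineDiamagnetism.ChessboardCellGain.StubDetPerturbIRAux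
  (re_trace_inv_mul_le)

variable {N : ℕ}

/-! ### Generic linear algebra: the tadpole trace against a coercive inverse, dimension explicit -/

section Generic

variable {ι : Type} [Fintype ι] [DecidableEq ι]

/-- **Tadpole trace, dimension-explicit.**  For coercive `B` (`c Σ‖v_i‖² ≤ Σ‖(Bv)_i‖²`, `c > 0`) and
`‖Δ‖_F² ≤ F`: `|Re tr (B⁻¹ Δ)| ≤ √(card ι · F / c)` (`Re tr (B⁻¹ (±Δ)) ≤ √(card ι/c) ‖Δ‖_F`). -/
theorem abs_re_trace_inv_mul_le_card (B Δ : Matrix ι ι ℂ) {c F : ℝ} (hc : 0 < c)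
    (hB : ∀ v : ι → ℂ, c * ∑ i, ‖v i‖ ^ 2 ≤ ∑ i, ‖(B.mulVec v) i‖ ^ 2)
    (h : ∑ i, ∑ j, ‖Δ i j‖ ^ 2 ≤ F) :
    |(B⁻¹ * Δ).trace.re| ≤ Real.sqrt (Fintype.card ι * F / c) := by
  have h1 := re_trace_inv_mul_le B Δ hc hB
  have h2 := re_trace_inv_mul_le B (-Δ) hc hB
  rw [Matrix.mul_neg, Matrix.trace_neg, Complex.neg_re] at h2
  simp only [Matrix.neg_apply, norm_neg] at h2
  have h0 : (0 : ℝ) ≤ Fintype.card ι / c := div_nonneg (Nat.cast_nonneg _) hc.le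
  have h3 : Real.sqrt (Fintype.card ι / c) * Real.sqrt (∑ i, ∑ j, ‖Δ i j‖ ^ 2) ≤
      Real.sqrt (Fintype.card ι * F / c) := by
    rw [← Real.sqrt_mul h0]
    refine Real.sqrt_le_sqrt ?_
    rw [mul_div_right_comm]
    exact mul_le_mul_of_nonneg_left h h0
  exact abs_le.mpr ⟨by linarith, h1.trans h3⟩

end Generic

/-! ### The block: index count, real scalars, Frobenius sums -/

/-- The block index type `(ℤ/2)⁴ × colour × spin` has `16 · N · 4 = 64 N` elements. -/
theorem card_index : (Fintype.card (TorusSite 4 2 × Fin N × Fin 4) : ℝ) = 64 * N := by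
  rw [Fintype.card_prod, Fintype.card_prod, Fintype.card_fin, Fintype.card_fin]
  norm_num [Fintype.card_fun, ZMod.card]
  ring

/-- `N · (1/N) ≤ 1` for a natural number cast to `ℝ` (it is `1` for `N ≠ 0` and `0` for `N = 0`). -/
theorem natCast_mul_one_div_le : (N : ℝ) * (1 / N) ≤ 1 := by
  rcases eq_or_ne (N : ℝ) 0 with h | h
  · rw [h]; norm_num
  · rw [mul_one_div_cancel h]

/-- Link sums: `Σ_e = Σ_μ Σ_x` on `Edge 4 2 = TorusSite 4 2 × Fin 4`. -/
theorem sum_edge_eq (E : Edge 4 2 → Matrix (Fin N) (Fin N) ℂ) :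
    ∑ e, ∑ a, ∑ b, ‖E e a b‖ ^ 2 =
      ∑ μ : Fin 4, ∑ x : TorusSite 4 2, ∑ a, ∑ b, ‖E (x, μ) a b‖ ^ 2 := by
  rw [Fintype.sum_prod_type, Finset.sum_comm]

/-- **Frobenius sum of the colour-scalar test field** `tst_μ = (1/N)·1` on the link `(0, μ)`:
`‖tst_μ‖² = N · ‖1/N‖² = N (1/N)²` (`= 1/N` for `N ≠ 0`, `= 0` for `N = 0`). -/
theorem tst_frob (μ : Fin 4) :
    ∑ e : Edge 4 2, ∑ a, ∑ b, ‖(if e = ((0 : TorusSite 4 2), μ) then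
        (1 / (N : ℂ)) • (1 : Matrix (Fin N) (Fin N) ℂ) else 0) a b‖ ^ 2 =
      (N : ℝ) * (1 / N) ^ 2 := by
  rw [Finset.sum_eq_single ((0 : TorusSite 4 2), μ) (fun e _ he => by simp [he]) (by simp)]
  simp only [if_true, Matrix.smul_apply, Matrix.one_apply, smul_eq_mul, mul_ite, mul_one,
    mul_zero]
  have ha : ∀ a : Fin N, ∑ b : Fin N, ‖(if a = b then (1 / (N : ℂ)) else 0)‖ ^ 2 =
      (1 / (N : ℝ)) ^ 2 := fun a => by
    rw [Finset.sum_eq_single a (fun b _ hb => by simp [Ne.symm hb]) (by simp)]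
    simp
  simp only [ha, Finset.sum_const, Finset.card_univ, Fintype.card_fin, nsmul_eq_mul]

/-- **Frobenius sum of the hopping form** (`N` colours).  With the hopping form `H(C⁺, C⁻)` of
`…StubTadpoleAuxAllN` (defining equation `hH`):
`‖H(C⁺, C⁻)‖_F² ≤ 2 Σ_μ (8 Σ_x ‖C⁺_μ(x)‖_F² + 8 Σ_x ‖C⁻_μ(x)‖_F²)`
(`TangentDelta.frob_kernel_le` with `‖1 ∓ γ_μ‖_F² = 8`). -/
theorem hop_frob_le
    {H : (Fin 4 → TorusSite 4 2 → Matrix (Fin N) (Fin N) ℂ) →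
      (Fin 4 → TorusSite 4 2 → Matrix (Fin N) (Fin N) ℂ) →
        Matrix (TorusSite 4 2 × Fin N × Fin 4) (TorusSite 4 2 × Fin N × Fin 4) ℂ}
    (hH : ∀ Cp Cm, H Cp Cm = Matrix.of fun p q : TorusSite 4 2 × Fin N × Fin 4 =>
      -(1 / 2 : ℂ) * ∑ μ : Fin 4,
        ((if q.1 = Literature.MathematicalPhysics.QuantumFieldTheory.Site.shift p.1 μ then
            ((1 : Matrix (Fin 4) (Fin 4) ℂ) - euclideanGamma μ) p.2.2 q.2.2 * Cp μ p.1 p.2.1 q.2.1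
          else 0) +
          (if p.1 = Literature.MathematicalPhysics.QuantumFieldTheory.Site.shift q.1 μ then
            ((1 : Matrix (Fin 4) (Fin 4) ℂ) + euclideanGamma μ) p.2.2 q.2.2 * Cm μ q.1 p.2.1 q.2.1
          else 0)))
    (Cp Cm : Fin 4 → TorusSite 4 2 → Matrix (Fin N) (Fin N) ℂ) :
    ∑ p, ∑ q, ‖H Cp Cm p q‖ ^ 2 ≤
      2 * ∑ μ, ((8 : ℝ) * ∑ x, ∑ a, ∑ b, ‖Cp μ x a b‖ ^ 2 +
        8 * ∑ x, ∑ a, ∑ b, ‖Cm μ x a b‖ ^ 2) := by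
  -- adapted from the sibling `BilinearBounds.hop_frob_le` (`Fin 3 ↦ Fin N`, textual)
  have h := TangentDelta.frob_kernel_le (L := 2)
    (fun μ => (1 : Matrix (Fin 4) (Fin 4) ℂ) - euclideanGamma μ)
    (fun μ => (1 : Matrix (Fin 4) (Fin 4) ℂ) + euclideanGamma μ) Cp Cm
  simp only [TangentDelta.sum_norm_sq_one_sub_gamma, TangentDelta.sum_norm_sq_one_add_gamma] at h
  simpa only [hH, Matrix.of_apply] using h

/-- **`‖Δ(E)‖_F² ≤ 32 ‖E‖²`** for the hopping perturbation `Δ(E) = H(uE, (uE)ᴴ)` with unitary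
direction factors `u_μ` (`N` colours; `hop_frob_le` + unitary and adjoint invariance of the Frobenius
sum). -/
theorem dl_frob_le
    {H : (Fin 4 → TorusSite 4 2 → Matrix (Fin N) (Fin N) ℂ) →
      (Fin 4 → TorusSite 4 2 → Matrix (Fin N) (Fin N) ℂ) →
        Matrix (TorusSite 4 2 × Fin N × Fin 4) (TorusSite 4 2 × Fin N × Fin 4) ℂ}
    (hH : ∀ Cp Cm, H Cp Cm = Matrix.of fun p q : TorusSite 4 2 × Fin N × Fin 4 =>
      -(1 / 2 : ℂ) * ∑ μ : Fin 4,
        ((if q.1 = Literature.MathematicalPhysics.QuantumFieldTheory.Site.shift p.1 μ then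
            ((1 : Matrix (Fin 4) (Fin 4) ℂ) - euclideanGamma μ) p.2.2 q.2.2 * Cp μ p.1 p.2.1 q.2.1
          else 0) +
          (if p.1 = Literature.MathematicalPhysics.QuantumFieldTheory.Site.shift q.1 μ then
            ((1 : Matrix (Fin 4) (Fin 4) ℂ) + euclideanGamma μ) p.2.2 q.2.2 * Cm μ q.1 p.2.1 q.2.1
          else 0)))
    (u : Fin 4 → Matrix.unitaryGroup (Fin N) ℂ) (E : Edge 4 2 → Matrix (Fin N) (Fin N) ℂ) :
    ∑ p, ∑ q, ‖H (fun μ x => (u μ : Matrix (Fin N) (Fin N) ℂ) * E (x, μ))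
        (fun μ y => ((u μ : Matrix (Fin N) (Fin N) ℂ) * E (y, μ))ᴴ) p q‖ ^ 2 ≤
      32 * ∑ e, ∑ a, ∑ b, ‖E e a b‖ ^ 2 := by
  refine (hop_frob_le hH _ _).trans (le_of_eq ?_)
  simp only [TangentDelta.sum_norm_sq_conjTranspose, TangentDelta.sum_norm_sq_unitary_mul]
  rw [sum_edge_eq E, Finset.mul_sum _ _ (2 : ℝ), Finset.mul_sum _ _ (32 : ℝ)]
  exact Finset.sum_congr rfl fun μ _ => by ring

open Summit.QuantumFields.QCD.Cruxes.FlatCellOptimal.Tadpole (hop_add hop_smul) in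
/-- **Sub-goal `stub_bilinearBoundsAllN` — bilinear bounds, every colour number `N`, dimension-free.**
On the `2⁴` block with `B⁰ = wilsonDirac ρ_N (fun e => u e.2) m 1` (constant direction-dependent
unitary links, defining equation) and the hopping perturbation `Δ(E)` (defining equation; ℝ-linear in
the link field `E : Edge 4 2 → M_N(ℂ)`): if `B⁰` is coercive with constant `c₀ > 0`, then
(a) `Δ(E₁ + E₂) = Δ(E₁) + Δ(E₂)`, (b) `Δ(r • E) = r • Δ(E)` (`r` real),
(c) `|Re tr (B⁰⁻¹Δ(E₁)B⁰⁻¹Δ(E₂))| ≤ (32/c₀) ‖E₁‖ ‖E₂‖`,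
(d) `|Re tr (B⁰⁻¹Δ(tst_μ))| ≤ 80/√c₀` for the colour-scalar test fields `tst_μ = (1/N)·1` on the link
`(0, μ)` — the sibling's (d) at its only point of use, now with an `N`-free constant.
Proof: `Tadpole.hop_add/hop_smul`; `|Re tr (PQ)| ≤ ‖P‖_F‖Q‖_F`, `‖B⁰⁻¹Δ‖_F² ≤ ‖Δ‖_F²/c₀`,
`‖Δ(E)‖_F² ≤ 32‖E‖²` (`dl_frob_le`); `|Re tr (B⁰⁻¹Δ)| ≤ √(64N · ‖Δ‖_F²/c₀)`, `‖tst_μ‖² = N(1/N)²`,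
`64N · 32 · N(1/N)² = 2048 (N/N)² ≤ 80²`. -/
theorem stub_bilinearBoundsAllN : ∀ (N : ℕ) (m : ℝ) (u : Fin 4 → Matrix.unitaryGroup (Fin N) ℂ) (c₀ : ℝ), 0 < c₀ → ∀ (B0 : Matrix (TorusSite 4 2 × Fin N × Fin 4) (TorusSite 4 2 × Fin N × Fin 4) ℂ) (Dl : (Edge 4 2 → Matrix (Fin N) (Fin N) ℂ) → Matrix (TorusSite 4 2 × Fin N × Fin 4) (TorusSite 4 2 × Fin N × Fin 4) ℂ), B0 = wilsonDirac (unitaryFundamentalRep (Fin N) ℂ) (fun e : Edge 4 2 => u e.2) m 1 → (∀ E, Dl E = Matrix.of fun (p q : TorusSite 4 2 × Fin N × Fin 4) => -(1 / 2 : ℂ) * ∑ μ : Fin 4, ((if q.1 = Site.shift p.1 μ then ((1 : Matrix (Fin 4) (Fin 4) ℂ) - euclideanGamma μ) p.2.2 q.2.2 * (((u μ : Matrix.unitaryGroup (Fin N) ℂ) : Matrix (Fin N) (Fin N) ℂ) * E (p.1, μ)) p.2.1 q.2.1 else 0) + (if p.1 = Site.shift q.1 μ then ((1 : Matrix (Fin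 4) (Fin 4) ℂ) + euclideanGamma μ) p.2.2 q.2.2 * (((u μ : Matrix.unitaryGroup (Fin N) ℂ) : Matrix (Fin N) (Fin N) ℂ) * E (q.1, μ))ᴴ p.2.1 q.2.1 else 0))) → (∀ v : TorusSite 4 2 × Fin N × Fin 4 → ℂ, c₀ * ∑ i, ‖v i‖ ^ 2 ≤ ∑ i, ‖(B0.mulVec v) i‖ ^ 2) → (∀ E₁ E₂ : Edge 4 2 → Matrix (Fin N) (Fin N) ℂ, Dl (E₁ + E₂) = Dl E₁ + Dl E₂) ∧ (∀ (r : ℝ) (E : Edge 4 2 → Matrix (Fin N) (Fin N) ℂ), Dl (r • E) = (r : ℂ) • Dl E) ∧ (∀ E₁ E₂ : Edge 4 2 → Matrix (Fin N) (Fin N) ℂ, |(B0⁻¹ * Dl E₁ * (B0⁻¹ * Dl E₂)).trace.re| ≤ 32 / c₀ * Real.sqrt (∑ e, ∑ a, ∑ b, ‖E₁ e a b‖ ^ 2) * Real.sqrt (∑ e, ∑ a, ∑ b, ‖E₂ e a b‖ ^ 2)) ∧ (∀ μ : Fin 4, |(B0⁻¹ * Dl (fun e : Edge 4 2 => if e =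 ((0 : TorusSite 4 2), μ) then (1 / (N : ℂ)) • (1 : Matrix (Fin N) (Fin N) ℂ) else 0)).trace.re| ≤ 80 / Real.sqrt c₀) := by
  intro N m u c₀ hc₀ B0 Dl _hB0 hDldef hB
  -- the hopping form `H`: `Δ(E) = H(uE, (uE)ᴴ)`
  obtain ⟨H, hH⟩ : ∃ H : (Fin 4 → TorusSite 4 2 → Matrix (Fin N) (Fin N) ℂ) →
      (Fin 4 → TorusSite 4 2 → Matrix (Fin N) (Fin N) ℂ) →
        Matrix (TorusSite 4 2 × Fin N × Fin 4) (TorusSite 4 2 × Fin N × Fin 4) ℂ,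
      ∀ Cp Cm, H Cp Cm = Matrix.of fun p q : TorusSite 4 2 × Fin N × Fin 4 =>
        -(1 / 2 : ℂ) * ∑ μ : Fin 4,
          ((if q.1 = Literature.MathematicalPhysics.QuantumFieldTheory.Site.shift p.1 μ then
              ((1 : Matrix (Fin 4) (Fin 4) ℂ) - euclideanGamma μ) p.2.2 q.2.2 * Cp μ p.1 p.2.1 q.2.1
            else 0) +
            (if p.1 = Literature.MathematicalPhysics.QuantumFieldTheory.Site.shift q.1 μ then
              ((1 : Matrix (Fin 4) (Fin 4) ℂ) + euclideanGamma μ) p.2.2 q.2.2 * Cm μ q.1 p.2.1 q.2.1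
            else 0)) :=
    ⟨_, fun _ _ => rfl⟩
  have hDl : ∀ E' : Edge 4 2 → Matrix (Fin N) (Fin N) ℂ,
      Dl E' = H (fun μ x => (u μ : Matrix (Fin N) (Fin N) ℂ) * E' (x, μ))
        (fun μ y => ((u μ : Matrix (Fin N) (Fin N) ℂ) * E' (y, μ))ᴴ) := fun E' => by
    rw [hDldef, hH]
  -- the Frobenius bound `‖Δ(E)‖_F² ≤ 32 ‖E‖²`
  have hF : ∀ E' : Edge 4 2 → Matrix (Fin N) (Fin N) ℂ,
      ∑ p, ∑ q, ‖Dl E' p q‖ ^ 2 ≤ 32 * ∑ e, ∑ a, ∑ b, ‖E' e a b‖ ^ 2 := fun E' => by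
    rw [hDl]
    exact dl_frob_le hH u E'
  refine ⟨fun E₁ E₂ => ?_, fun r E => ?_, fun E₁ E₂ => ?_, fun μ => ?_⟩
  · -- (a) additivity
    have h1 : (fun μ x => (u μ : Matrix (Fin N) (Fin N) ℂ) * (E₁ + E₂) (x, μ)) =
        (fun μ x => (u μ : Matrix (Fin N) (Fin N) ℂ) * E₁ (x, μ)) +
          fun μ x => (u μ : Matrix (Fin N) (Fin N) ℂ) * E₂ (x, μ) := by
      funext μ x; simp [Matrix.mul_add]
    have h2 : (fun μ y => ((u μ : Matrix (Fin N) (Fin N) ℂ) * (E₁ + E₂) (y, μ))ᴴ) =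
        (fun μ y => ((u μ : Matrix (Fin N) (Fin N) ℂ) * E₁ (y, μ))ᴴ) +
          fun μ y => ((u μ : Matrix (Fin N) (Fin N) ℂ) * E₂ (y, μ))ᴴ := by
      funext μ y; simp [Matrix.mul_add, Matrix.conjTranspose_add]
    rw [hDl, hDl, hDl, h1, h2, hop_add hH]
  · -- (b) real homogeneity (real scalars act through the coercion `ℝ → ℂ`)
    have real_smul_eq : ∀ M : Matrix (Fin N) (Fin N) ℂ, r • M = (r : ℂ) • M := fun M => by
      ext a b
      simp only [Matrix.smul_apply, Complex.real_smul, smul_eq_mul]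
    have h1 : (fun μ x => (u μ : Matrix (Fin N) (Fin N) ℂ) * (r • E) (x, μ)) =
        (r : ℂ) • fun μ x => (u μ : Matrix (Fin N) (Fin N) ℂ) * E (x, μ) := by
      funext μ x
      simp only [Pi.smul_apply, real_smul_eq, Matrix.mul_smul]
    have h2 : (fun μ y => ((u μ : Matrix (Fin N) (Fin N) ℂ) * (r • E) (y, μ))ᴴ) =
        (r : ℂ) • fun μ y => ((u μ : Matrix (Fin N) (Fin N) ℂ) * E (y, μ))ᴴ := by
      funext μ y
      simp only [Pi.smul_apply, real_smul_eq, Matrix.mul_smul, Matrix.conjTranspose_smul,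
        Complex.star_def, Complex.conj_ofReal]
    rw [hDl, hDl, h1, h2, hop_smul hH]
  · -- (c) the bubble
    exact abs_re_trace_bubble_le B0 (Dl E₁) (Dl E₂) hc₀ hB (hF E₁) (hF E₂)
  · -- (d) the tadpole at the colour-scalar test field `tst_μ`
    have h := abs_re_trace_inv_mul_le_card B0
      (Dl (fun e : Edge 4 2 => if e = ((0 : TorusSite 4 2), μ) then
        (1 / (N : ℂ)) • (1 : Matrix (Fin N) (Fin N) ℂ) else 0)) hc₀ hB (hF _)
    rw [card_index, tst_frob] at h
    refine h.trans ?_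
    have hNN : 0 ≤ (N : ℝ) * (1 / N) := by positivity
    have hsq : ((N : ℝ) * (1 / N)) ^ 2 ≤ 1 := pow_le_one₀ hNN natCast_mul_one_div_le
    have hnum : 64 * (N : ℝ) * (32 * ((N : ℝ) * (1 / N) ^ 2)) ≤ 80 ^ 2 :=
      calc 64 * (N : ℝ) * (32 * ((N : ℝ) * (1 / N) ^ 2)) = 2048 * ((N : ℝ) * (1 / N)) ^ 2 := by
            ring
        _ ≤ 2048 * 1 := mul_le_mul_of_nonneg_left hsq (by norm_num)
        _ ≤ 80 ^ 2 := by norm_num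
    calc Real.sqrt (64 * (N : ℝ) * (32 * ((N : ℝ) * (1 / N) ^ 2)) / c₀)
        ≤ Real.sqrt (80 ^ 2 / c₀) := Real.sqrt_le_sqrt (div_le_div_of_nonneg_right hnum hc₀.le)
      _ = 80 / Real.sqrt c₀ := by
          rw [Real.sqrt_div' _ hc₀.le, Real.sqrt_sq (by norm_num)]

end Summit.QuantumFields.QCD.Cruxes.FlatCellOptimal.BilinearBounds

end
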